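/-
Copyright (c) 2026 the pub-hodgecm-mathlib formalisation cell (harness21).  Prover seat hodgecm-mathlib-K2Liu-p09 (g2): Track B «K2-LIT», #184♮ = hLiu418,
payer-internal step (an) of file #34 `Theorems/K2LiuDoublingZetaGL1.lean` (LEAD F0P6-plan (g10) DEAL K2/STATUS 2026-09-04T02:36:29Z; DEPMAP v2.5 §8 (an), §10 TABLE A
rows «definiteness elsewhere» ∕ «degree»).
-/
import Literature.NumberTheory.Automorphic.Liu2021.CurveThetaNonOrthogonal
import Literature.NumberTheory.Automorphic.ArchCongruenceTransport
import HarnessLib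

/-!
# Crux `HLiu418`, Track B road `K2_Liu`, file #34 — step (an): ANISOTROPY OF `H` FROM THE LETTER'S BINDERS `hg`, `hpos`, `h4L`

Cell `hodgecm-mathlib`, crux item hLiu418 = `stmt-HodgeConjecture-24832`, route of record `HCCMUnconditional`; squad K2 ∕ K2Liu, LEAD F0P6-plan (g10),
prover K2Liu-p09 (g2).  THEOREMS ONLY (no `def`, no instance, no notation, no named-fact hypothesis, no `sorry`, default heartbeats); lane
`--supports stmt-HodgeConjecture-24832 --as helper` (count-neutral).

★ #13 `sig_K2LiuDoublingUnfold` (U5 :140, ★ `K2LiuDoublingUnfold.doublingUnfold`) binds the anisotropy of `H`,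
`_hanis : ∀ x, hermForm c H x x = 0 → x = 0`, which is NOT among s23's binders; s23 (tier-0 `DoublingZetaGL1` rev. k :340–:347) instead carries
`hg : ᵗc(g) (t • H) g = diagonal dV`, `hpos : (diagonal dV)^{τ'}` positive definite at every complex embedding `τ'` off the place of `ι`, and
`h4L : 4 ≤ [L : ℚ]`.  This file derives `_hanis` from exactly these three:
* `exists_embedding_mk_ne` — a CM field with `4 ≤ [L : ℚ]` has an embedding `τ'` with `mk τ' ≠ mk ι` (`[L : ℚ] = 2 · #places`, ★ Mathlib
  `card_eq_nrRealPlaces_add_nrComplexPlaces` + `IsTotallyComplex.finrank`);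
* `formCongr_inv_formCongr` — `ᵗσ(g⁻¹) (ᵗσ(g) X g) g⁻¹ = X`;
* `anisotropic_of_formCongr_eq_diagonal` — `diagonal dV` anisotropic (★ `UnitaryGroup.anisotropic_of_posDef_map` at `τ'`) ⇒ `t • H = ᵗc(g⁻¹)(diagonal dV)g⁻¹`
  anisotropic (★ `UnitaryGroup.anisotropic_formCongr_cm`) ⇒ `H` anisotropic (`⟪x,x⟫_{tH} = t⟪x,x⟫_H`; no `t ≠ 0` needed in this direction).

HONEST LABEL: HC_CM is proved only modulo the printed citations (2 remaining named inputs: hLiu418 = stmt-HodgeConjecture-24832,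
h413 = stmt-HodgeConjecture-24833) until rung 0 closes; this file is bookkeeping toward socket s23 and closes no item.
-/

set_option autoImplicit false
set_option linter.dupNamespace false

open NumberField
open scoped Matrix ComplexOrder
open Literature.NumberTheory.Automorphic Literature.NumberTheory.Automorphic.UnitaryGroup

namespace Summit.HodgeConjecture.HodgeConjecture.Cruxes.HLiu418.K2LiuDoublingZetaGL1Anisotropy

variable (L : Type) [Field L] [NumberField L] [IsCMField L]

/-- A CM field of degree `≥ 4` has at least two infinite places: for every embedding `ι` there is an embedding `τ'` defining a different place
(`[L : ℚ] = 2 · #(infinite places)` for a totally complex field). [folklore] -/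
theorem exists_embedding_mk_ne (h4L : 4 ≤ Module.finrank ℚ L) (ι : L →+* ℂ) :
    ∃ τ' : L →+* ℂ, InfinitePlace.mk τ' ≠ InfinitePlace.mk ι := by
  have hcard : Module.finrank ℚ L = 2 * Fintype.card (InfinitePlace L) := by
    rw [InfinitePlace.card_eq_nrRealPlaces_add_nrComplexPlaces,
      NumberField.nrRealPlaces_eq_zero_iff.2 (IsCMField.isTotallyComplex L), zero_add]
    exact IsTotallyComplex.finrank L
  have h2 : 1 < Fintype.card (InfinitePlace L) := by omega
  obtain ⟨w, hw⟩ := Fintype.exists_ne_of_one_lt_card h2 (InfinitePlace.mk ι)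
  exact ⟨w.embedding, by rwa [InfinitePlace.mk_embedding]⟩

/-- `ᵗσ(g⁻¹) · (ᵗσ(g) · X · g) · g⁻¹ = X`: congruence by `g⁻¹` undoes congruence by `g`. [folklore] -/
theorem formCongr_inv_formCongr {R : Type*} [CommRing R] {m : Type*} [Fintype m] [DecidableEq m] (σ : R →+* R) (g : GL m R)
    (X : Matrix m m R) : formCongr σ g⁻¹ (formCongr σ g X) = X := by
  have h1 : ((g : GL m R) : Matrix m m R).map σ * (((g⁻¹ : GL m R) : Matrix m m R).map σ) = 1 := by
    rw [← Matrix.map_mul, ← Units.val_mul, mul_inv_cancel, Units.val_one, Matrix.map_one σ (map_zero σ) (map_one σ)]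
  have h2 : ((g : GL m R) : Matrix m m R) * ((g⁻¹ : GL m R) : Matrix m m R) = 1 := by
    rw [← Units.val_mul, mul_inv_cancel, Units.val_one]
  simp only [formCongr]
  calc (((g⁻¹ : GL m R) : Matrix m m R).map σ)ᵀ * ((((g : GL m R) : Matrix m m R).map σ)ᵀ * X * (g : Matrix m m R)) *
        ((g⁻¹ : GL m R) : Matrix m m R)
      = ((((g : GL m R) : Matrix m m R).map σ) * (((g⁻¹ : GL m R) : Matrix m m R).map σ))ᵀ * X *
          (((g : GL m R) : Matrix m m R) * ((g⁻¹ : GL m R) : Matrix m m R)) := by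
        rw [Matrix.transpose_mul]
        simp only [Matrix.mul_assoc]
    _ = X := by rw [h1, h2, Matrix.transpose_one, Matrix.one_mul, Matrix.mul_one]

/-- **(an) of the #34 dictionary.**  Under s23's binders `hg : ᵗc(g)(t • H)g = diagonal dV`, `hpos` (positive definiteness of `(diagonal dV)^{τ'}`
at the embeddings off the place of `ι`) and `h4L : 4 ≤ [L : ℚ]`, the Hermitian matrix `H` is ANISOTROPIC over `L`: `⟪x, x⟫_H = 0 ⇒ x = 0` — the
hypothesis `_hanis` of ★ #13 `K2LiuDoublingUnfold.doublingUnfold`.  (Pick `τ'` by `exists_embedding_mk_ne`; `diagonal dV` is anisotropic by ★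
`anisotropic_of_posDef_map`; transport along `t • H = ᵗc(g⁻¹)(diagonal dV)g⁻¹` by ★ `anisotropic_formCongr_cm`; `⟪x,x⟫_{t•H} = t·⟪x,x⟫_H`.)
[cite: Liu2021, Lem. B.11 p. 102] -/
theorem anisotropic_of_formCongr_eq_diagonal (ι : L →+* ℂ) {N : ℕ} (H : Matrix (Fin N) (Fin N) L) (dV : Fin N → L) (t : L)
    (g : GL (Fin N) L)
    (hg : formCongr ((IsCMField.complexConj L : L ≃ₐ[↥(maximalRealSubfield L)] L) : L →+* L) g (t • H) = Matrix.diagonal dV)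
    (hpos : ∀ τ' : L →+* ℂ, InfinitePlace.mk τ' ≠ InfinitePlace.mk ι → ((Matrix.diagonal dV).map τ').PosDef)
    (h4L : 4 ≤ Module.finrank ℚ L) :
    ∀ x : Fin N → L, hermForm (cmConjRingHom L) H x x = 0 → x = 0 := by
  obtain ⟨τ', hτ'⟩ := exists_embedding_mk_ne L h4L ι
  have hV : ∀ x : Fin N → L, hermForm (cmConjRingHom L) (Matrix.diagonal dV) x x = 0 → x = 0 :=
    UnitaryGroup.anisotropic_of_posDef_map L (Matrix.diagonal dV) τ' (hpos τ' hτ')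
  have htH : ∀ x : Fin N → L, hermForm (cmConjRingHom L) (t • H) x x = 0 → x = 0 := by
    have h := UnitaryGroup.anisotropic_formCongr_cm L g⁻¹ hV
    rw [← hg] at h
    intro x hx
    refine h x ?_
    have e : formCongr (cmConjRingHom L) g⁻¹
        (formCongr ((IsCMField.complexConj L : L ≃ₐ[↥(maximalRealSubfield L)] L) : L →+* L) g (t • H)) = t • H :=
      formCongr_inv_formCongr (cmConjRingHom L) g (t • H)
    rw [e]
    exact hx
  intro x hx
  refine htH x ?_
  have h1 : hermForm (cmConjRingHom L) (t • H) x x = t * hermForm (cmConjRingHom L) H x x := by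
    simp only [hermForm, Matrix.smul_mulVec, dotProduct_smul, smul_eq_mul]
  rw [h1, hx, mul_zero]

end Summit.HodgeConjecture.HodgeConjecture.Cruxes.HLiu418.K2LiuDoublingZetaGL1Anisotropy
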